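import Mathlib
import Summits.NavierStokesRegularity.NavierStokesRegularity.Theorems.EulerZoomLiouvillePowerGaugeEulerLiouvilleSelfSimilarKelvinFarField
import Literature.Analysis.FluidPDE.HeatExtensionVanishingAtInfinity
import Literature.Analysis.FluidPDE.VectorCalculusProofs
import HarnessLib.Audit

/-!
# Rung C1 of the crux `EulerZoomLiouville.PowerGaugeEulerLiouville`: COMPACT VORTICITY SUPPORT at the
# energy-conserving endpoint from the self-similar Kelvin law (`γ = 2/5`, classical profiles)

Route №10 `EulerZoomLiouville` (NavierStokesRegularity), crux E = stmt-NavierStokesRegularity-19832,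
tenure rung C1, registered residue `stub_selfSimilarExtremal` (exactly self-similar members with
extremal profile; at `ρ = 1/2` extremality is automatic).  Sequel to `…SelfSimilarKelvinFarField`.
PROFILE LEVEL:

* `setIntegral_annulus_le_of_shell` — dyadic shell decay `∫_{l≤|x|<2l}|V|² ≤ C l^{−β}` sums to
  `∫_{r≤|x|<2^N r}|V|² ≤ N C r^{−β}` (induction on `N`);
* `integral_inner_eq_zero_of_shellDecay` — **far-field vorticity is invisible to the energy**:
  if the shells decay with SOME `β` making the Kelvin exponent negative,
  `1 − 5γ/2 + ε − βγ/2 < 0`, then `∫ ⟪V, B⟫ = 0` for every compactly supported divergence-free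
  `B` supported far out (the far-field Kelvin bound decays in `s` while the left side is constant);
* `hasCompactSupport_curl_of_shellDecay` — **at `γ = 2/5`, a smooth bounded profile with bounded
  gradient tending to `0` at infinity, `V ∈ L²`, and shells decaying like ANY power `β > 0`, has
  COMPACTLY SUPPORTED VORTICITY** (`B = curl(g eᵢ)`, `∫ ⟪V, curl A⟫ = ∫ ⟪curl V, A⟫`, fundamental
  lemma on the open far region, continuity).

Combined with the tree's `selfSimilar_ae_eq_zero_of_hasCompactSupport_curl` (stratum A of
`…SelfSimilarVorticity`: a classical profile with compactly supported vorticity is trivial in the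
class, every `ρ`) and the endpoint shell drain `shell_energy_decay_half` (`L^{−5+ε}`), this closes
the CLASSICAL endpoint case of the stub (`…SelfSimilarEndpointSmooth`).

WHAT THIS IS NOT: not NS, not E, not rung C1 — the weak-class endpoint (profiles merely `H¹_loc`)
and the whole window `ρ < 1/2` are untouched; `DV → 0` at infinity is assumed, not derived.

## References

* P. Constantin, M. Ignatova, V. Vicol, arXiv:2602.17570 (2026), §3.4.2, Remark 3.6.
  [ConstantinIgnatovaVicol2026Putative]
* D. Chae, R. Shvydkoy, ARMA 209 (2013) = arXiv:1201.6009, §3.1, §4 Thm 4.2 (iii). [ChaeShvydkoy2013]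
-/

noncomputable section

-- flat `Theorems/<Route><Decl>…` files of one crux share the namespace of the crux (tree convention)
set_option linter.dupNamespace false

open MeasureTheory Set Filter Topology Metric Function InnerProductSpace
open scoped RealInnerProductSpace NNReal ENNReal ContDiff

namespace Summit.NavierStokesRegularity.NavierStokesRegularity.Theorems.PowerGaugeEulerLiouville.Kelvin

open Literature.Analysis Literature.Analysis.FluidPDE

variable {γ : ℝ} {V : EuclideanSpace ℝ (Fin 3) → EuclideanSpace ℝ (Fin 3)}

/-- **Dyadic shell decay sums to annulus decay**: if `∫_{L ≤ |x| < 2L} |V|² ≤ C L^{−β}` for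
`L ≥ R₀ > 0` then `∫_{r ≤ |x| < 2^N r} |V|² ≤ N C r^{−β}` for `r ≥ R₀` (induction on `N`).
[cite: ChaeShvydkoy2013, §3.1, proof of Thm 3.1 (dyadic shells)] -/
theorem setIntegral_annulus_le_of_shell (hV2 : Integrable (fun x => ‖V x‖ ^ 2) volume)
    {β C R₀ : ℝ} (hβ : 0 ≤ β) (hC : 0 ≤ C) (hR₀ : 0 < R₀)
    (hshell : ∀ L : ℝ, R₀ ≤ L →
      ∫ x in {x | L ≤ ‖x‖ ∧ ‖x‖ < 2 * L}, ‖V x‖ ^ 2 ≤ C * L ^ (-β))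
    (N : ℕ) {r : ℝ} (hr : R₀ ≤ r) :
    ∫ x in {x | r ≤ ‖x‖ ∧ ‖x‖ < 2 ^ N * r}, ‖V x‖ ^ 2 ≤ N * C * r ^ (-β) := by
  induction N with
  | zero =>
    have h0 : {x : EuclideanSpace ℝ (Fin 3) | r ≤ ‖x‖ ∧ ‖x‖ < 2 ^ 0 * r} = ∅ := by
      ext x; simp only [pow_zero, one_mul, mem_setOf_eq, mem_empty_iff_false, iff_false, not_and,
        not_lt]; exact fun h => h
    rw [h0, Measure.restrict_empty, integral_zero_measure]; simp
  | succ N ih =>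
    have hr0 : 0 < r := hR₀.trans_le hr
    have hsplit : {x : EuclideanSpace ℝ (Fin 3) | r ≤ ‖x‖ ∧ ‖x‖ < 2 ^ (N + 1) * r} =
        {x | r ≤ ‖x‖ ∧ ‖x‖ < 2 ^ N * r} ∪ {x | 2 ^ N * r ≤ ‖x‖ ∧ ‖x‖ < 2 * (2 ^ N * r)} := by
      ext x
      simp only [mem_setOf_eq, mem_union, pow_succ]
      constructor
      · rintro ⟨h1, h2⟩
        by_cases h : ‖x‖ < 2 ^ N * r
        · exact Or.inl ⟨h1, h⟩
        · exact Or.inr ⟨not_lt.1 h, by linarith⟩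
      · rintro (⟨h1, h2⟩ | ⟨h1, h2⟩)
        · exact ⟨h1, by nlinarith [pow_pos (two_pos : (0:ℝ) < 2) N]⟩
        · exact ⟨le_trans (le_mul_of_one_le_left hr0.le (one_le_pow₀ (by norm_num))) h1, by linarith⟩
    have hdisj : Disjoint {x : EuclideanSpace ℝ (Fin 3) | r ≤ ‖x‖ ∧ ‖x‖ < 2 ^ N * r}
        {x | 2 ^ N * r ≤ ‖x‖ ∧ ‖x‖ < 2 * (2 ^ N * r)} :=
      disjoint_left.2 fun x hx hx' => (not_le.2 hx.2) hx'.1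
    have hm2 : MeasurableSet {x : EuclideanSpace ℝ (Fin 3) | 2 ^ N * r ≤ ‖x‖ ∧ ‖x‖ < 2 * (2 ^ N * r)} :=
      (measurableSet_le measurable_const measurable_norm).inter
        (measurableSet_lt measurable_norm measurable_const)
    rw [hsplit, setIntegral_union hdisj hm2 hV2.integrableOn hV2.integrableOn]
    have hsh := hshell (2 ^ N * r) (hr.trans (le_mul_of_one_le_left hr0.le (one_le_pow₀ (by norm_num))))
    have hmono : C * (2 ^ N * r) ^ (-β) ≤ C * r ^ (-β) :=
      mul_le_mul_of_nonneg_left (rpow_neg_le_rpow_neg_of_le hr0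
        (le_mul_of_one_le_left hr0.le (one_le_pow₀ (by norm_num))) hβ) hC
    push_cast
    nlinarith [ih, hsh, hmono]

/-- **Far-field vorticity is invisible to the energy: `∫ ⟪V, B⟫ = 0`** for every compactly
supported divergence-free `B` supported in `{|y| ≥ L}` (`L − M/γ ≥ max(R, R₀)`), provided the
dyadic shell energies decay, `∫_{l ≤ |x| < 2l}|V|² ≤ C l^{−β}` (`l ≥ R₀ > 0`), and the Kelvin
exponent beats the tail: `1 − 5γ/2 + ε − βγ/2 < 0` (at the energy-conserving endpoint `γ = 2/5`
this reads `ε < βγ/2`: ANY power `β > 0` suffices once `DV` is small at infinity).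
[cite: ConstantinIgnatovaVicol2026Putative, §3.4.2 Remark 3.6 (the exponent test, here at spatial infinity)] -/
theorem integral_inner_eq_zero_of_shellDecay (hγ : 0 < γ) (hV : ContDiff ℝ ∞ V) {K : ℝ}
    (hK : ∀ y, ‖fderiv ℝ V y‖ ≤ K) {M : ℝ} (hM : ∀ y, ‖V y‖ ≤ M)
    {P : EuclideanSpace ℝ (Fin 3) → ℝ} (hprof : IsSelfSimilarEulerProfile γ 0 V P)
    (hV2 : Integrable (fun x => ‖V x‖ ^ 2) volume)
    {ε R : ℝ} (hε : ∀ z : EuclideanSpace ℝ (Fin 3), R ≤ ‖z‖ → ‖fderiv ℝ V z‖ ≤ ε)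
    {β C R₀ : ℝ} (hβ : 0 ≤ β) (hC : 0 ≤ C) (hR₀ : 0 < R₀)
    (hshell : ∀ l : ℝ, R₀ ≤ l → ∫ x in {x | l ≤ ‖x‖ ∧ ‖x‖ < 2 * l}, ‖V x‖ ^ 2 ≤ C * l ^ (-β))
    (hrate : 1 - 5 * γ / 2 + ε - β * γ / 2 < 0)
    {L : ℝ} (hLR : R ≤ L - M / γ) (hLR₀ : R₀ ≤ L - M / γ)
    {B : EuclideanSpace ℝ (Fin 3) → EuclideanSpace ℝ (Fin 3)} (hB : ContDiff ℝ ∞ B)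
    (hBc : HasCompactSupport B) (hBdiv : VectorCalculus.IsDivFree B)
    (hBL : ∀ y ∈ tsupport B, L ≤ ‖y‖) :
    ∫ y, ⟪V y, B y⟫ = 0 := by
  obtain ⟨Bmax, hBmax⟩ := hB.continuous.bounded_above_of_compact_support hBc
  set ℓ := L - M / γ with hℓ
  have hℓ0 : 0 < ℓ := hR₀.trans_le hLR₀
  -- the support lies in a closed ball; choose the dyadic width of the annulus
  obtain ⟨L', hL'⟩ := (hBc : IsCompact (tsupport B)).isBounded.subset_closedBall (0 : EuclideanSpace ℝ (Fin 3))
  obtain ⟨N, hN⟩ : ∃ N : ℕ, L' + M / γ < 2 ^ N * ℓ := by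
    obtain ⟨N, hN⟩ := pow_unbounded_of_one_lt ((L' + M / γ) / ℓ) (by norm_num : (1 : ℝ) < 2)
    exact ⟨N, by rwa [div_lt_iff₀ hℓ0] at hN⟩
  have hTL' : ∀ y ∈ tsupport B, ‖y‖ ≤ L' := fun y hy => mem_closedBall_zero_iff.1 (hL' hy)
  set κ := 1 - 5 * γ / 2 + ε - β * γ / 2 with hκ
  set C' : ℝ := N * C * ℓ ^ (-β) with hC'
  have hC'0 : 0 ≤ C' := by positivity
  set A₀ := Bmax * (C' + (volume (tsupport B)).toReal) / 2 with hA₀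
  have hbound : ∀ s : ℝ, 0 ≤ s → |∫ y, ⟪V y, B y⟫| ≤ A₀ * Real.exp (κ * s) := by
    intro s hs
    refine abs_integral_inner_le_exp_of_image (γ := γ) hγ hV hK hM hprof hV2 hε hLR hB hBc hBdiv
      hBL hBmax hs ?_
    have hsub := image_subset_annulus (γ := γ) hV hK hM hγ hs hBL hTL' hN
    have hr : R₀ ≤ ℓ * Real.exp (γ * s) :=
      hLR₀.trans (le_mul_of_one_le_right hℓ0.le (Real.one_le_exp (by positivity)))
    calc ∫ x in ODE.evolutionMap (fun _ : ℝ => selfSimilarTransport γ 0 V) 0 s '' tsupport B, ‖V x‖ ^ 2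
        ≤ ∫ x in {x | ℓ * Real.exp (γ * s) ≤ ‖x‖ ∧ ‖x‖ < 2 ^ N * (ℓ * Real.exp (γ * s))},
            ‖V x‖ ^ 2 :=
          setIntegral_mono_set hV2.integrableOn (Eventually.of_forall fun x => by positivity)
            (Eventually.of_forall hsub)
      _ ≤ N * C * (ℓ * Real.exp (γ * s)) ^ (-β) :=
          setIntegral_annulus_le_of_shell hV2 hβ hC hR₀ hshell N hr
      _ = C' * Real.exp (-(β * γ * s)) := by
          rw [hC', Real.mul_rpow hℓ0.le (Real.exp_pos _).le, ← Real.exp_mul]; ring_nf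
  by_contra hne
  have hpos : 0 < |∫ y, ⟪V y, B y⟫| := abs_pos.2 hne
  have htend : Tendsto (fun s : ℝ => A₀ * Real.exp (κ * s)) atTop (𝓝 0) := by
    have h1 : Tendsto (fun s : ℝ => Real.exp (κ * s)) atTop (𝓝 0) :=
      Real.tendsto_exp_atBot.comp (tendsto_id.const_mul_atTop_of_neg hrate)
    simpa using h1.const_mul A₀
  obtain ⟨s, hs1, hs2⟩ := ((htend.eventually (gt_mem_nhds hpos)).and (eventually_ge_atTop 0)).exists
  exact (lt_irrefl _ ((hbound s hs2).trans_lt hs1))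

/-- A continuous function vanishing a.e. on an open set vanishes there. [folklore] -/
theorem eq_zero_of_ae_of_isOpen {f : EuclideanSpace ℝ (Fin 3) → ℝ} (hf : Continuous f)
    {U : Set (EuclideanSpace ℝ (Fin 3))} (hU : IsOpen U)
    (hae : ∀ᵐ x ∂(volume : Measure (EuclideanSpace ℝ (Fin 3))), x ∈ U → f x = 0) {y : EuclideanSpace ℝ (Fin 3)}
    (hy : y ∈ U) : f y = 0 := by
  by_contra hne
  set W := U ∩ f ⁻¹' {0}ᶜ with hW
  have hWo : IsOpen W := hU.inter (isOpen_compl_singleton.preimage hf)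
  have hyW : y ∈ W := ⟨hy, hne⟩
  have hnull : volume {x : EuclideanSpace ℝ (Fin 3) | ¬(x ∈ U → f x = 0)} = 0 := ae_iff.1 hae
  have hW0 : volume W = 0 :=
    measure_mono_null (fun x hx => by
      simp only [mem_setOf_eq, Classical.not_imp]
      exact ⟨hx.1, hx.2⟩) hnull
  exact (hWo.measure_pos volume ⟨y, hyW⟩).ne' hW0

/-- **At the energy-conserving endpoint the vorticity of a classical finite-energy profile has
compact support.** `γ = 2/5`, `V` smooth and bounded with bounded gradient tending to `0` at
infinity, dyadic shell energies `∫_{l ≤ |x| < 2l}|V|² ≤ C l^{−β}` (`l ≥ R₀ > 0`) for some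
`β > 0` ⇒ `curl V` vanishes outside
a ball (test the far-field identity with `B = curl (g eᵢ)`, `∫ ⟪V, curl A⟫ = ∫ ⟪curl V, A⟫`, and
the fundamental lemma of the calculus of variations on the open far region).
[cite: ConstantinIgnatovaVicol2026Putative, §3.4.2 Remark 3.6; ChaeShvydkoy2013, §4 Thm 4.2 (iii)] -/
theorem hasCompactSupport_curl_of_shellDecay (hγ : γ = 2 / 5) (hV : ContDiff ℝ ∞ V) {K : ℝ}
    (hK : ∀ y, ‖fderiv ℝ V y‖ ≤ K) {M : ℝ} (hM : ∀ y, ‖V y‖ ≤ M)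
    {P : EuclideanSpace ℝ (Fin 3) → ℝ} (hprof : IsSelfSimilarEulerProfile γ 0 V P)
    (hV2 : Integrable (fun x => ‖V x‖ ^ 2) volume)
    (hDV : Tendsto (fderiv ℝ V) (cocompact (EuclideanSpace ℝ (Fin 3))) (𝓝 0))
    {β C R₀ : ℝ} (hβ : 0 < β) (hC : 0 ≤ C) (hR₀ : 0 < R₀)
    (hshell : ∀ l : ℝ, R₀ ≤ l → ∫ x in {x | l ≤ ‖x‖ ∧ ‖x‖ < 2 * l}, ‖V x‖ ^ 2 ≤ C * l ^ (-β)) :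
    HasCompactSupport (curl V) := by
  have hγ0 : 0 < γ := by rw [hγ]; norm_num
  -- the Kelvin exponent beats the tail once `‖DV‖ ≤ ε := βγ/4` far out
  set ε : ℝ := β * γ / 4 with hεdef
  have hε0 : 0 < ε := by positivity
  have hrate : 1 - 5 * γ / 2 + ε - β * γ / 2 < 0 := by
    rw [hεdef, hγ]; nlinarith
  obtain ⟨R, hR⟩ := (tendsto_cocompact_nhds_zero_iff_norm.1 hDV) ε hε0
  -- the radius beyond which the test fields live
  set ℓ : ℝ := max R R₀ with hℓ
  set L : ℝ := ℓ + M / γ with hL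
  have hLℓ : L - M / γ = ℓ := by rw [hL]; ring
  have hLR : R ≤ L - M / γ := by rw [hLℓ, hℓ]; exact le_max_left _ _
  have hLR₀ : R₀ ≤ L - M / γ := by rw [hLℓ, hℓ]; exact le_max_right _ _
  have key : ∀ B : EuclideanSpace ℝ (Fin 3) → EuclideanSpace ℝ (Fin 3), ContDiff ℝ ∞ B →
      HasCompactSupport B → VectorCalculus.IsDivFree B → (∀ y ∈ tsupport B, L ≤ ‖y‖) →
      ∫ y, ⟪V y, B y⟫ = 0 := fun B hB hBc hBdiv hBL =>
    integral_inner_eq_zero_of_shellDecay (γ := γ) hγ0 hV hK hM hprof hV2 hR hβ.le hC hR₀ hshell hrate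
      hLR hLR₀ hB hBc hBdiv hBL
  -- `curl V = 0` on the open far region
  set U : Set (EuclideanSpace ℝ (Fin 3)) := {y | L < ‖y‖} with hU
  have hUo : IsOpen U := isOpen_lt continuous_const continuous_norm
  have hV1 : ContDiff ℝ 1 V := hV.of_le (mod_cast le_top)
  have hcurlc : Continuous (curl V) := (contDiff_curl (n := 0) (by simpa using hV1)).continuous
  have hcomp : ∀ i : Fin 3, ∀ y ∈ U, (curl V y) i = 0 := by
    intro i y hy
    have hci : Continuous fun x => (curl V x) i := (PiLp.continuous_apply 2 _ i).comp hcurlc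
    refine eq_zero_of_ae_of_isOpen hci hUo ?_ hy
    refine hUo.ae_eq_zero_of_integral_contDiff_smul_eq_zero
      (hci.locallyIntegrable.locallyIntegrableOn U) fun g hg hgc hgU => ?_
    -- the test field `A = g eᵢ` and `B = curl A`
    set A : EuclideanSpace ℝ (Fin 3) → EuclideanSpace ℝ (Fin 3) :=
      fun x => g x • EuclideanSpace.single i (1 : ℝ) with hA
    have hAs : ContDiff ℝ ∞ A := hg.smul contDiff_const
    have hAc : HasCompactSupport A := hgc.smul_right
    have hBs : ContDiff ℝ ∞ (curl A) := contDiff_curl (n := ⊤) (by simpa using hAs)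
    have hBc : HasCompactSupport (curl A) := hasCompactSupport_curl hAc
    have hBdiv : VectorCalculus.IsDivFree (curl A) := fun x =>
      divergence_curl_eq_zero_holds A (hAs.of_le (by norm_cast)) x
    have hBL : ∀ y ∈ tsupport (curl A), L ≤ ‖y‖ := by
      intro y hy
      have h1 : tsupport (curl A) ⊆ tsupport A :=
        closure_minimal (fun x hx => by
          by_contra hxA
          exact hx (curl_eq_zero_of_notMem_tsupport hxA)) (isClosed_tsupport A)
      have h2 : tsupport A ⊆ tsupport g := tsupport_smul_subset_left _ _
      exact le_of_lt (hgU (h2 (h1 hy)))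
    have h0 := key (curl A) hBs hBc hBdiv hBL
    rw [← integral_inner_curl_eq_integral_inner_curl hV1 (hAs.of_le (mod_cast le_top)) hAc] at h0
    rw [← h0]
    refine integral_congr_ae (Eventually.of_forall fun x => ?_)
    simp only [hA, inner_smul_right, EuclideanSpace.inner_single_right, one_mul, conj_trivial,
      smul_eq_mul]
  have hcurl : ∀ y ∈ U, curl V y = 0 := fun y hy =>
    PiLp.ext fun i => by simpa using hcomp i y hy
  refine HasCompactSupport.intro (isCompact_closedBall (0 : EuclideanSpace ℝ (Fin 3)) L)
    fun x hx => hcurl x ?_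
  rw [mem_closedBall_zero_iff, not_le] at hx
  exact hx


end Summit.NavierStokesRegularity.NavierStokesRegularity.Theorems.PowerGaugeEulerLiouville.Kelvin

end
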